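/-
Origin: expansion seat `planner-pub-hodgecm-mc-axioms-1-g14-0`, handover #W231 2026-08-20T15:53:55Z md5 575655bc0837 (PKG d278d53a884b → 575655bc0837; 158 l.; MECHANICAL (iib-R) rewrite v3.1 of the PKG file as it stands (7 token edits; rules R1x1+RX[h₂]x6)) (`HOME/mc/pub-hodgecm-mc-axioms-1-g14/revendor/kit-r55/stage55/HodgeCM/Model/Binders/Real34BaseLetterP2.lean`, md5 575655bc0837, 158 lines);
landed by the gen-22 packager (p-g22) in gate run 55 REPLACES the earlier landed copy of `HodgeCM/Model/Binders/Real34BaseLetterP2.lean` (seat copy carried the packager Origin header of an earlier run (stripped)).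
-/
/-
Origin: speedrun cell pub-hodgecm, MODEL-CONSTRUCTION sub-cell, unit pub-hodgecm-mc-binder-1-g13 (BINDER PROVER, gen 13; S RE-PIN P2 = the R2 shape:
binder-1's P-pin module `Binders/Real34BaseLetter` re-typed at sinst-1's PREDICATE-GUARDED DOUBLY-TWISTED pin `SInstance.SGPT' @G @hG @hGR @η @hη @hηc @ν @hν @hνc
@ν' @hν' @hν'c @hGR₀..₃ @AG` (#1228 `ThetaAdelicSideGuardedT2`; E's R2 pin `SROGT'CJ` is its instance), exactly as gen 10 re-typed the total layer at `SGP`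
(K34-PLAN §3): `SGP ↦ SGPT'`, `thetaAdelicSideOfP_X ↦ thetaAdelicSideOfPT'_X`, `archSideOf ↦ archSideOfT'` (period-1 #P50b read-backs), six ν-families
added to every parameter pack, namespace `Gen12PinsP ↦ Gen12PinsP2`; statements and proofs otherwise VERBATIM; the pin-free helpers of `Binders/Real34BaseLetter`
are NOT re-declared (that module is imported)), seat prover-pub-hodgecm-mc-binder-1-g13-0, 2026-08-20.
Target in PKG: HodgeCM/Model/Binders/Real34BaseLetterP2.lean (NEW additive leaf).  KERNEL ONLY; 0 records of published theorems, nothing cited, 0 `def … : Prop`;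
MODEL-N ±0; E unchanged.  Nothing here is a claim of the manuscripts under adjudication.
-/
import Summits.HodgeConjecture.HodgeCM.Model.Binders.Real34BaseLetter
import Summits.HodgeConjecture.HodgeCM.Model.Binders.Real34LettersP2

/-!
**P2 RE-PIN (binder-1-g13) of `Binders/Real34BaseLetter` at sinst-1's guarded doubly-twisted pin `SInstance.SGPT'` (R2 shape; E's `SROGT'C(J)` is an
instance).**  The module text below is the original's, to be read with `SGP ↦ SGPT'`, `AG : … lineRepD … ↦ … lineRepT' … ν ν'`, `archSideOf ↦ archSideOfT'`,
`thetaAdelicSideOfP_X ↦ thetaAdelicSideOfPT'_X`, namespace `Gen12PinsP ↦ Gen12PinsP2`; pin-free helpers are imported from the original, not restated.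
# Only the BASE letter tuple is matched: row 15's census residual is one period identity per `(χ, f)` on `insM f φ₀`

The characters `χ : ((pinT …).t34 V c).X` of the (34) junction are, by definition of the pin, the characters of `[T]` of archimedean
type `(−μ c 2, −μ c 3)` (`SeesawTorus.allowedChars`), and binder-2's census prints its places with the vacuum characters PINNED to the
same exponents (`pinnedVacs core.kind (−μ c 2) (−μ c 3)`).  pv11's `PrintedTorusMatch` says exactly that the joint printed character
is then the inverse of the typed weight; so on the printed torus `dualChar χ = (∏_b χ_b)⁻¹` (§ 1 `dualChar_printedTorus_eq_inv_prod`).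
Consequently a letter tuple `n` (RUN-46 `Binders/Real34Letters`) is MATCHED to `χ` iff its weight ratio `∏_{b : sigma} (u_{b,1}u_{b,2}⁻¹)^{n_b}`
is identically `1`, i.e. iff `n_b = 0` at every `sigma` place (§ 1 `sigma_exponent_eq_zero_of_matched`; test point `u ↦ (e^{iπ/n_b}, 1)` at
one place) — and then the letter tensor IS the base vector `φ₀ = ⊗_b φ⁰_b` (`letterOf_eq_φ`).

* § 2 **`Gen12PinsP2.Real34CensusSideT.ofBase (hW) core (hbase)`** — the census-T record of RUN-44 #41 from binder-2's (34) core and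
  **(W-0)** `hbase : ∀ χ f, ∃ Ψ : SK, Ψ.val ∈ admWedgeSpan … ((SGP …) V c) hV ∧ (t34 V c).ϑ χ (insM f φ₀) = (t34 V c).ϑ χ Ψ` —
  ONE (34)-period identity per character `χ` and finite index `f`, on the single base vector `φ₀` of the printed places.

So after this leaf row 15 (= glue-1's `CT` binder of #399T) needs, per good sextic context: the (34) core TERM, and for each `(χ, f)` an
admissible wedge sum (RUN-45 #46 supplies them from carch's `k = 2, 3` archimedean `K`-type data) with the same `ϑ₃₄(χ, ·)`-period as
`insM f φ₀` — nothing about general printed vectors, eigenletters or exponent tuples remains.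
-/

set_option autoImplicit false

noncomputable section

open MeasureTheory NumberField MulAction
open scoped Matrix InnerProductSpace TensorProduct

attribute [-instance] Quotient.instMeasurableSpace

namespace HodgeCM.Model

open HodgeCM HodgeCM.Universe HodgeCM.Adelic HodgeCM.Model.HypCensus
open HodgeCM.PerL34 HodgeCM.PerL34.Fock HodgeCM.PerL34.Fock.PrintDict HodgeCM.PerL34.Annihilation
open Literature.NumberTheory.Weil1964
open Literature.NumberTheory.Automorphic (piSchwartzBruhat)
open Literature.NumberTheory.GelbartRogawski1991.UnitaryDualPair
open Literature.AlgebraicGeometry.HodgeTheory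
open Literature.NumberTheory.Automorphic.PicardCM
open Literature.NumberTheory.Transcendental (Arapura2012_Cor_15_4_6)
open HodgeCM.Model.ThetaSpace
open HodgeCM.Model.ArchSideTerm
open NumberField.SeesawArchTorus (toAdeles printedTorusHom printedTorusHom_apply placesEquiv)
open HodgeCM.PerL34.Fock.LocalFock NumberField.SeesawTorus NumberField.SeesawArchTorus

/-! ## 1. The base letter, the weight ratio, and the character identity on the printed torus -/

section BaseGeneric

variable (lam : ℂ) (hlam : lam ≠ 0) (vac : Circle × Circle →* Circle)

end BaseGeneric

section PrintedTorus

variable {L : CMField} [DecidableEq (InfinitePlace (L : Type))]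
  (kind : InfinitePlace (L : Type) → PlaceKind) (lam : InfinitePlace (L : Type) → ℂ) (hlam : ∀ w, lam w ≠ 0)
  (m₁ m₂ : InfinitePlace (L : Type) → ℤ)

end PrintedTorus

/-! ## 2. The census-T record from the core and one period identity per `(χ, f)` on the base vector -/

namespace Gen12PinsP2

variable
  (G : ∀ {L : CMField} {ι₁ : L →+* ℂ} (_V : HermSpace3 L ι₁) (_c : SeesawCtx L), Prop)
  (hG : ∀ {L : CMField} {ι₁ : L →+* ℂ} (V : HermSpace3 L ι₁) (c : SeesawCtx L),
    G V c → (∀ j, 0 < (ι₁ (dW c.D j)).re) ∨ ∀ j, (ι₁ (dW c.D j)).re < 0)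
  (hGR : ∀ {L : CMField} {ι₁ : L →+* ℂ} (V : HermSpace3 L ι₁) (c : SeesawCtx L),
    (cmSplittingDatum (L : Type) finProdFinEquiv (frameD V) (frameD_real V) (frameD_ne V) (dW c.D) (dW_real c.D)
      (dW_ne c.D)).CompatibleSplitting)
  (η : ∀ {L : CMField} {ι₁ : L →+* ℂ} (V : HermSpace3 L ι₁) (c : SeesawCtx L),
    CMAdelic (L : Type) (frameD V) × CMAdelic (L : Type) (dW c.D) →* ℂˣ)
  (hη : ∀ {L : CMField} {ι₁ : L →+* ℂ} (V : HermSpace3 L ι₁) (c : SeesawCtx L),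
    ∀ γU ∈ CMRat (L : Type) (frameD V), ∀ γ ∈ CMRat (L : Type) (dW c.D), η V c (γU, γ) = 1)
  (hηc : ∀ {L : CMField} {ι₁ : L →+* ℂ} (V : HermSpace3 L ι₁) (c : SeesawCtx L), Continuous fun p => ((η V c p : ℂˣ) : ℂ))
  (ν : ∀ {L : CMField} {ι₁ : L →+* ℂ} (V : HermSpace3 L ι₁) (_c : SeesawCtx L), CMAdelic (L : Type) (frameD V) →* ℂˣ)
  (hν : ∀ {L : CMField} {ι₁ : L →+* ℂ} (V : HermSpace3 L ι₁) (c : SeesawCtx L), ∀ γU ∈ CMRat (L : Type) (frameD V), ν V c γU = 1)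
  (hνc : ∀ {L : CMField} {ι₁ : L →+* ℂ} (V : HermSpace3 L ι₁) (c : SeesawCtx L), Continuous fun v => ((ν V c v : ℂˣ) : ℂ))
  (ν' : ∀ {L : CMField} {ι₁ : L →+* ℂ} (V : HermSpace3 L ι₁) (_c : SeesawCtx L), CMAdelic (L : Type) (frameD V) →* ℂˣ)
  (hν' : ∀ {L : CMField} {ι₁ : L →+* ℂ} (V : HermSpace3 L ι₁) (c : SeesawCtx L), ∀ γU ∈ CMRat (L : Type) (frameD V), ν' V c γU = 1)
  (hν'c : ∀ {L : CMField} {ι₁ : L →+* ℂ} (V : HermSpace3 L ι₁) (c : SeesawCtx L), Continuous fun v => ((ν' V c v : ℂˣ) : ℂ))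
  (hGR₀ : ∀ {L : CMField} {ι₁ : L →+* ℂ} (V : HermSpace3 L ι₁) (c : SeesawCtx L),
    (cmSplittingDatum (L : Type) (e₁) (frameD V) (frameD_real V) (frameD_ne V) (lineVec (L : Type) (dW c.D 0))
      (fun _ => dW_real c.D 0) (fun _ => dW_ne c.D 0)).CompatibleSplitting)
  (hGR₁ : ∀ {L : CMField} {ι₁ : L →+* ℂ} (V : HermSpace3 L ι₁) (c : SeesawCtx L),
    (cmSplittingDatum (L : Type) (e₁) (frameD V) (frameD_real V) (frameD_ne V) (lineVec (L : Type) (dW c.D 1))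
      (fun _ => dW_real c.D 1) (fun _ => dW_ne c.D 1)).CompatibleSplitting)
  (hGR₂ : ∀ {L : CMField} {ι₁ : L →+* ℂ} (V : HermSpace3 L ι₁) (c : SeesawCtx L),
    (cmSplittingDatum (L : Type) (e₁) (frameD V) (frameD_real V) (frameD_ne V) (lineVec (L : Type) (dW' c.D 0))
      (fun _ => dW'_real c.D 0) (fun _ => dW'_ne c.D 0)).CompatibleSplitting)
  (hGR₃ : ∀ {L : CMField} {ι₁ : L →+* ℂ} (V : HermSpace3 L ι₁) (c : SeesawCtx L),
    (cmSplittingDatum (L : Type) (e₁) (frameD V) (frameD_real V) (frameD_ne V) (lineVec (L : Type) (dW' c.D 1))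
      (fun _ => dW'_real c.D 1) (fun _ => dW'_ne c.D 1)).CompatibleSplitting)
  (AG : ∀ {L : CMField} {ι₁ : L →+* ℂ} (V : HermSpace3 L ι₁) (c : SeesawCtx L), G V c → ∀ k : Fin 4,
    ArchLineInput V (lineRepT' V c.D (hGR V c) (hGR₀ V c) (hGR₁ V c) (hGR₂ V c) (hGR₃ V c) (η V c) (ν V c) (ν' V c) k))

variable (hHD : exists_isReal_hodgeModel) (hI : hodgePQ_independent_of_hodgeModel)
  (h₁ : BallQuotientUniformised)  (h₃ : CMAbelianVarietyRealised)
  (h : Bool) (hA : Arapura2012_Cor_15_4_6) (μ : ∀ {L : CMField}, SeesawCtx L → Fin 4 → InfinitePlace L → ℤ)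

section Context34

variable {L : CMField} {ι₁ : L →+* ℂ} (V : HermSpace3 L ι₁) (c : SeesawCtx L) (hV : IsAnisotropic L V.Hm)

/-- **`Real34CensusSideT` from the (34) census core and ONE period identity per `(χ, f)` on the base vector `φ₀`** ((W-0) `hbase`).
From `ofLetters`: a matched letter tuple has exponent `0` at the `sigma` places (`sigma_exponent_eq_zero_of_matched`, the character `χ`
being of the pinned archimedean type by `χ.2`), hence is the base tuple, whose letter tensor is `φ₀` (`letterOf_eq_φ`). -/
def Real34CensusSideT.ofBase (hW : IsAnisotropic L c.D.gramW)
    (core : HypCoreW ((Gen12Pins.Wg @hGR @η @hη @hηc @Gen12Pins.τSyl @Gen12Pins.TSyl @Gen12Pins.hTSyl) V c) c.D.jT₃₄ (fun w => -μ c 2 w) (fun w => -μ c 3 w))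
    (hbase : letI := core.decEq
      ∀ (χ : ((pinT hHD hI h₁ h₃ h hA (Gen12Pins.Wg @hGR @η @hη @hηc @Gen12Pins.τSyl @Gen12Pins.TSyl @Gen12Pins.hTSyl) (SInstance.SGPT' @G @hG @hGR @η @hη @hηc @ν @hν @hνc @ν' @hν' @hν'c @hGR₀ @hGR₁ @hGR₂ @hGR₃ @AG) μ).t34 V c).X) (f : core.side.FinIdx),
        ∃ Ψ : ↥((wmOf' printFact_unitaryCompact_holds ((Gen12Pins.Wg @hGR @η @hη @hηc @Gen12Pins.τSyl @Gen12Pins.TSyl @Gen12Pins.hTSyl) V c)).SK),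
          (Subtype.val Ψ : piSchwartzBruhat (↥(maximalRealSubfield L)) (Fin 6)) ∈
              admWedgeSpan hHD hI h₁ h₃ ((SInstance.SGPT' @G @hG @hGR @η @hη @hηc @ν @hν @hνc @ν' @hν' @hν'c @hGR₀ @hGR₁ @hGR₂ @hGR₃ @AG) V c) hV ∧
            ((pinT hHD hI h₁ h₃ h hA (Gen12Pins.Wg @hGR @η @hη @hηc @Gen12Pins.τSyl @Gen12Pins.TSyl @Gen12Pins.hTSyl) (SInstance.SGPT' @G @hG @hGR @η @hη @hηc @ν @hν @hνc @ν' @hν' @hν'c @hGR₀ @hGR₁ @hGR₂ @hGR₃ @AG) μ).t34 V c).ϑ χ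
                (insM printFact_unitaryCompact_holds ((Gen12Pins.Wg @hGR @η @hη @hηc @Gen12Pins.τSyl @Gen12Pins.TSyl @Gen12Pins.hTSyl) V c) c.D.jT₃₄ core.kind core.lam core.hlam
                  (fun w => -μ c 2 w) (fun w => -μ c 3 w) core.side f (printPlaces (InfinitePlace (L : Type)) core.kind core.lam core.hlam (pinnedVacs core.kind (fun w => -μ c 2 w) (fun w => -μ c 3 w))).φ₀) =
              ((pinT hHD hI h₁ h₃ h hA (Gen12Pins.Wg @hGR @η @hη @hηc @Gen12Pins.τSyl @Gen12Pins.TSyl @Gen12Pins.hTSyl) (SInstance.SGPT' @G @hG @hGR @η @hη @hηc @ν @hν @hνc @ν' @hν' @hν'c @hGR₀ @hGR₁ @hGR₂ @hGR₃ @AG) μ).t34 V c).ϑ χ Ψ) :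
    Real34CensusSideT @G @hG @hGR @η @hη @hηc @ν @hν @hνc @ν' @hν' @hν'c @hGR₀ @hGR₁ @hGR₂ @hGR₃ @AG hHD hI h₁ h₃ h hA @μ V c hV :=
  Real34CensusSideT.ofLetters @G @hG @hGR @η @hη @hηc @ν @hν @hνc @ν' @hν' @hν'c @hGR₀ @hGR₁ @hGR₂ @hGR₃ @AG hHD hI h₁ h₃ h hA @μ V c hV hW core (by
    letI := core.decEq
    intro χ f n hmt
    have hn : ∀ b, core.kind b = .sigma ∨ core.kind b = .sigmaSwap → n b = 0 :=
      sigma_exponent_eq_zero_of_matched core.kind core.lam core.hlam (fun w => -μ c 2 w) (fun w => -μ c 3 w) χ.1 χ.2 n hmt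
    have hfun : (fun b : (printPlaces (InfinitePlace (L : Type)) core.kind core.lam core.hlam (pinnedVacs core.kind (fun w => -μ c 2 w) (fun w => -μ c 3 w))).RP => letterOf (core.lam b) (core.hlam b) ((pinnedVacs core.kind (fun w => -μ c 2 w) (fun w => -μ c 3 w)) b) (core.kind b) (n b)) =
        fun b : (printPlaces (InfinitePlace (L : Type)) core.kind core.lam core.hlam (pinnedVacs core.kind (fun w => -μ c 2 w) (fun w => -μ c 3 w))).RP => (printLoc (core.lam b) (core.hlam b) ((pinnedVacs core.kind (fun w => -μ c 2 w) (fun w => -μ c 3 w)) b) (core.kind b)).φ :=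
      funext fun b => letterOf_eq_φ (core.lam b) (core.hlam b) ((pinnedVacs core.kind (fun w => -μ c 2 w) (fun w => -μ c 3 w)) b) (core.kind b) (n b) (hn b)
    rw [hfun]
    exact hbase χ f)

end Context34

end Gen12PinsP2

end HodgeCM.Model

end
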